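import Literature.AlgebraicGeometry.Resolution.CurveCentreNearPointUnique
import Literature.AlgebraicGeometry.Resolution.BlowupChartRsop
import Literature.AlgebraicGeometry.Resolution.BlowupDimension
import HarnessLib

/-!
# A near point over a point of a curve centre is a regular point of the same embedding dimension
# (CoP1, Lemma 4.3 (4): "`x′ := (y₁′ = y₁, y₂′ = y₂/y₁, y₃)`")

Topic: `Literature/AlgebraicGeometry/Resolution`. [CoP1] = Cossart–Piltant, J. Algebra 320 (2008)
1051–1082, Lemma 4.3 (4) and its proof, pp. 8–9: over a point `x` of a permissible curve centre
`Y = V(y₁, y₂)` with `D_x = k(x)·Y₂` (adapted coordinates), "the only point in `q⁻¹(x)` which may be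
very near `x` is the point `x′ := (y₁′ = y₁, y₂′ = y₂/y₁, y₃)`" — the origin of the `y₁`-chart, a
point of the blown-up regular scheme with regular parameters `(y₁, y₂/y₁, y₃)`, in particular of
the SAME embedding dimension as `x`. This is the input that keeps the chain of the termination
proof of Prop. 4.4 inside "closed points of a regular threefold" across CURVE steps (the hypothesis
`spanFinrank 𝔪 = 3` of `false_of_nearChain_tau_two` / of the `τ = 1` chain); the point-centre
companion is `IsBlowup.spanFinrank_eq_three_of_isNear_point` (`NearPointsPointCentreUnique.lean`).
PROVED here (no definitions, no facts), on top of `CurveCentreNearPointUnique.lean` (uniqueness,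
shear to adapted coordinates) and the chart regularity theorem `isRsopPart_chartFamily_reesChart`
(`BlowupChartRsop.lean`, de Jong 2.4 / Stacks 0BIQ):

* `chartGen_mem_of_near_of_adapted` — ring level: in adapted coordinates a near prime of the
  `c_j`-chart is its ORIGIN (`e_l = c_l/c_j ∈ 𝔴`);
* `isRegularLocalRing_and_spanFinrank_eq_of_origin` — ring level: the local ring of the chart at
  an origin prime over `𝔪` is regular of the same embedding dimension as `R`;
* `IsBlowup.isRegularLocalRing_and_spanFinrank_eq_of_isNear_curve_of_adapted`,
  `IsBlowup.isRegularLocalRing_and_spanFinrank_eq_of_isNear_curve` — **scheme level (adapted /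
  coordinate free): at a near point `x′` over a point of the curve centre, `𝒪_{X′,x′}` is regular
  and `emb.dim 𝒪_{X′,x′} = emb.dim 𝒪_{X,π x′}`;**
* `span_range_chartFamily_eq_maximalIdeal_of_origin`, `IsBlowup.exists_chart_rsop_of_isNear_curve_of_adapted`
  — the regular parameters `(c_j, c_l/c_j, w)` at the near point (the printed `(y₁, y₂/y₁, y₃)`), i.e.
  the curve-chart data `c′₁ = φ u₁`, `φ y = φ u₁ · y′`, `c′₂ = φ u₂` consumed by `CurveStepPrepared.lean`.

Cell res-hironaka, F-71 census (`plan/inputs/F71-CENSUS-v1.md`): a located brick for S2/S3.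

## Sources

* V. Cossart, O. Piltant, J. Algebra 320 (2008) 1051–1082, Lemma 4.3 (4) and its proof, pp. 8–9.
  [CossartPiltant2008]
* A. J. de Jong, Publ. Math. IHÉS 83 (1996), 2.4 (regular parameters on blow-up charts).
  [DeJong1996]
-/

noncomputable section

open CategoryTheory CategoryTheory.Limits AlgebraicGeometry TopologicalSpace IsLocalRing MvPolynomial

namespace Literature.AlgebraicGeometry.Resolution

universe u

open Scheme.IdealSheafData

/-- Two distinct indices of `Fin 2` different from a third one do not exist. [folklore] -/
private theorem Fin.eq_of_ne_of_ne' {j j' l : Fin 2} (h₁ : j' ≠ j) (h₂ : l ≠ j) : j' = l := by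
  revert j j' l
  decide

/-- `c₀ · Y_l^μ = c₀′ · (Y_j − a Y_l)^μ ≠ 0` is impossible for `l ≠ j`, `μ ≥ 1` (evaluate at
`Y_j = 1`, `Y_l = 0`). [folklore] -/
private theorem false_of_eq_C_mul_pow_of_eq_C_mul_sub_pow' {k : Type*} [CommRing k] {j l : Fin 2}
    (hl : l ≠ j) {μ : ℕ} (hμ : 1 ≤ μ) {G : MvPolynomial (Fin 2) k} (hG0 : G ≠ 0) {c₀ c₀' a : k}
    (h₁ : G = C c₀ * X l ^ μ) (h₂ : G = C c₀' * (X j - C a * X l) ^ μ) : False := by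
  have hμ0 : μ ≠ 0 := by omega
  let φ : MvPolynomial (Fin 2) k →+* k := eval fun i => if i = j then 1 else 0
  have hφ₁ : φ G = 0 := by
    rw [h₁, map_mul, map_pow]
    simp [φ, hl, zero_pow hμ0]
  have hφ₂ : φ G = c₀' := by
    rw [h₂, map_mul, map_pow, map_sub, map_mul]
    simp [φ, hl]
  have hc₀' : c₀' = 0 := by rw [← hφ₂, hφ₁]
  apply hG0
  rw [h₂, hc₀', map_zero, zero_mul]

variable {X X' : Scheme.{u}} {π : X' ⟶ X}

/-- `c₀ · (Y_l − a Y_j)^μ = c₀′ · Y_l^μ ≠ 0` forces `a = 0` (evaluate at `Y_j = 1`, `Y_l = a`).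
[folklore] -/
private theorem eq_zero_of_eq_C_mul_sub_pow_of_eq_C_mul_pow {k : Type*} [Field k] {j l : Fin 2}
    (hl : l ≠ j) {μ : ℕ} (hμ : 1 ≤ μ) {G : MvPolynomial (Fin 2) k} (hG0 : G ≠ 0) {c₀ c₀' a : k}
    (h₁ : G = MvPolynomial.C c₀ * (MvPolynomial.X l - MvPolynomial.C a * MvPolynomial.X j) ^ μ)
    (h₂ : G = MvPolynomial.C c₀' * MvPolynomial.X l ^ μ) : a = 0 := by
  have hμ0 : μ ≠ 0 := by omega
  let φ : MvPolynomial (Fin 2) k →+* k := MvPolynomial.eval fun i => if i = j then 1 else a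
  have hφl : φ (MvPolynomial.X l) = a := by simp [φ, hl]
  have hφj : φ (MvPolynomial.X j) = 1 := by simp [φ]
  have hφ₁ : φ G = 0 := by
    rw [h₁, map_mul, map_pow, map_sub, map_mul, hφl, hφj]
    simp [φ, zero_pow hμ0]
  have hφ₂ : φ G = c₀' * a ^ μ := by
    rw [h₂, map_mul, map_pow, hφl]
    simp [φ]
  have hc₀' : c₀' ≠ 0 := by
    rintro rfl
    exact hG0 (by rw [h₂, map_zero, zero_mul])
  have : c₀' * a ^ μ = 0 := by rw [← hφ₂, hφ₁]
  rcases mul_eq_zero.mp this with h | h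
  · exact absurd h hc₀'
  · exact pow_eq_zero_iff hμ0 |>.mp h

/-- **In adapted coordinates a near prime of the `c_j`-chart is its ORIGIN**: `e_l = c_l/c_j ∈ 𝔴`
([CoP1] Lemma 4.3 (4), proof: "the only point in `q⁻¹(x)` which may be very near `x` is the point
`x′ := (y₁′ = y₁, y₂′ = y₂/y₁, y₃)`"). Ring level: `c = (c_0, c_1) ⊆ 𝔪` quasi-regular, every
initial form of `J` w.r.t. `c` a multiple of `Y_l^μ`, `𝔴 ⊇ 𝔪 B_j` a prime of the `j`-th chart at
which the weak transforms of the degree-`μ` forms of `J` are near, and some such form with non-zero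
reduction exists. [cite: CossartPiltant2008, Lemma 4.3 (4) (proof)] -/
theorem chartGen_mem_of_near_of_adapted {R : Type u} [CommRing R] [IsLocalRing R]
    (c : Fin 2 → R) (j : Fin 2) {l : Fin 2} (hl : l ≠ j) (hcq : IsQuasiRegular c)
    (hcm : ∀ i, c i ∈ maximalIdeal R) {J : Ideal R} {μ : ℕ} (hμ : 1 ≤ μ)
    (𝔴 : Ideal (chartRing c j)) [𝔴.IsPrime] (h𝔴 : (maximalIdeal R).map (chartBase c j) ≤ 𝔴)
    (hnear : ∀ F : MvPolynomial (Fin 2) R, F.IsHomogeneous μ → MvPolynomial.eval c F ∈ J →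
      (algebraMap (chartRing c j) (Localization.AtPrime 𝔴) :
          chartRing c j →+* Localization.AtPrime 𝔴)
          (MvPolynomial.eval₂Hom (chartBase c j) (fun i => chartGen c j i) F) ∈
        maximalIdeal (Localization.AtPrime 𝔴) ^ μ)
    (hadapt : ∀ G ∈ initialForms c J μ, ∃ c₀ : ResidueField R,
      G = MvPolynomial.C c₀ * MvPolynomial.X l ^ μ)
    {F : MvPolynomial (Fin 2) R} (hF : F.IsHomogeneous μ) (hFJ : MvPolynomial.eval c F ∈ J)
    (hF0 : MvPolynomial.map (residue R) F ≠ 0) :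
    chartGen c j l ∈ 𝔴 := by
  classical
  obtain ⟨ρ, hρsurj, hρker, hρF⟩ :
      ∃ ρ : chartRing c j →+* MvPolynomial {i : Fin 2 // i ≠ j} (ResidueField R),
        Function.Surjective ρ ∧ RingHom.ker ρ = (maximalIdeal R).map (chartBase c j) ∧
        ∀ F : MvPolynomial (Fin 2) R,
          ρ (MvPolynomial.eval₂Hom (chartBase c j) (fun i => chartGen c j i) F) =
            MvPolynomial.map (residue R) (dehomogenize j F) :=
    exists_chartResidueMap c j hcq hcm
  obtain ⟨a, c₀, hqa, hga⟩ := exists_map_residue_eq_C_mul_X_sub_C_mul_X_pow c j hl hρsurj hρker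
    hρF hμ hF hF0 𝔴 h𝔴 (hnear F hF hFJ)
  obtain ⟨c₀', hc₀'⟩ := hadapt _ ((mem_initialForms_iff c).mpr ⟨F, hF, hFJ, rfl⟩)
  have ha0 : a = 0 := eq_zero_of_eq_C_mul_sub_pow_of_eq_C_mul_pow hl hμ hF0 hga hc₀'
  -- `𝔴 = ρ⁻¹(ρ(𝔴))` and `ρ(e_l) = T_l ∈ ρ(𝔴) = (T_l)`
  have hker : RingHom.ker ρ ≤ 𝔴 := hρker.trans_le h𝔴
  have hcomap : 𝔴 = (𝔴.map ρ).comap ρ := by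
    rw [Ideal.comap_map_of_surjective ρ hρsurj, ← RingHom.ker_eq_comap_bot, sup_eq_left.mpr hker]
  have hρl : ρ (chartGen c j l) = MvPolynomial.X ⟨l, hl⟩ :=
    map_chartGen_of_chartResidueMap c j hρF hl
  rw [hcomap, Ideal.mem_comap, hρl, hqa, ha0, map_zero, sub_zero]
  exact Ideal.subset_span rfl

/-- **At the origin of the `c_j`-chart of the blowing up along the pair `c`, the local ring is
regular of the same embedding dimension as `R`** (de Jong 2.4 / Stacks 0BIQ via
`isRsopPart_chartFamily_reesChart`: `(c_j, e_l, w)` is part of a regular system of parameters of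
the local ring, `w` completing `c` to a regular system of parameters of `R`; and
`dim ≤ dim R`). [cite: CossartPiltant2008, Lemma 4.3 (4) (proof)] -/
theorem isRegularLocalRing_and_spanFinrank_eq_of_origin {R : Type u} [CommRing R]
    [IsRegularLocalRing R] {c : Fin 2 → R} (hcr : IsRsopPart c) (j : Fin 2) {l : Fin 2} (hl : l ≠ j)
    (𝔴 : Ideal (chartRing c j)) [𝔴.IsPrime] (h𝔴 : 𝔴.comap (chartBase c j) = maximalIdeal R)
    (he : chartGen c j l ∈ 𝔴) (L : Type u) [CommRing L] [IsLocalRing L] [Algebra (chartRing c j) L]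
    [IsLocalization.AtPrime L 𝔴] :
    IsRegularLocalRing L ∧ (maximalIdeal L).spanFinrank = (maximalIdeal R).spanFinrank := by
  classical
  obtain ⟨e, x, hd, hx, hxc⟩ := hcr.exists_rsop
  let w : Fin e → R := fun k => x (Fin.natAdd 2 k)
  have happ : Fin.append c w = x := by
    funext i
    refine Fin.addCases (fun k => ?_) (fun k => ?_) i
    · rw [Fin.append_left, ← hxc]
    · rw [Fin.append_right]
  have hz : Ideal.span (Set.range (Fin.append c w)) = maximalIdeal R := by rw [happ, hx]
  have hrsop := isRsopPart_chartFamily_reesChart c j w hz hd 𝔴 h𝔴 L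
    (fun _ : Fin 1 => (⟨l, hl⟩ : {i : Fin 2 // i ≠ j})) (fun a b _ => Subsingleton.elim a b)
    (fun _ => he)
  haveI hLreg : IsRegularLocalRing L := hrsop.isRegularLocalRing
  obtain ⟨e', y, hdim, hy, -⟩ := hrsop.exists_rsop
  haveI := isDomain_of_isRegularLocalRing R
  have hdimL : ringKrullDim L ≤ ringKrullDim R := ringKrullDim_localization_chartRing_le c j 𝔴 h𝔴 L
  have hR : ((maximalIdeal R).spanFinrank : WithBot ℕ∞) = ringKrullDim R :=
    IsRegularLocalRing.spanFinrank_maximalIdeal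
  have hL : ((maximalIdeal L).spanFinrank : WithBot ℕ∞) = ringKrullDim L :=
    IsRegularLocalRing.spanFinrank_maximalIdeal
  rw [← hR, ← hL, hd, hdim] at hdimL
  have he0 : e' = 0 := by
    have : 1 + e + 1 + e' ≤ 2 + e := by exact_mod_cast hdimL
    omega
  refine ⟨hLreg, ?_⟩
  rw [hdim, hd, he0]
  ring

/-- **[CoP1] Lemma 4.3 (4): a near point over a point of a curve centre is a regular point of the
same embedding dimension** (adapted coordinates): for the blowing up `π` of the regular locally
Noetherian `X` along the regular centre `Y ⊆ {ord J = μ}` cut out at `x = π x′` by the adapted pair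
`c` (initial forms multiples of `Y_l^μ`), if `x′` is near then `𝒪_{X′,x′}` is regular and
`emb.dim 𝒪_{X′,x′} = emb.dim 𝒪_{X,x}` ("`x′ := (y₁′ = y₁, y₂′ = y₂/y₁, y₃)`" is the origin of the
chart: `NearPointsRational`, `chartGen_mem_of_near_of_adapted`). Curve-centre companion of
`IsBlowup.spanFinrank_eq_three_of_isNear_point`. [cite: CossartPiltant2008, Lemma 4.3 (4)] -/
theorem IsBlowup.isRegularLocalRing_and_spanFinrank_eq_of_isNear_curve_of_adapted
    [IsLocallyNoetherian X] [IsLocallyNoetherian X'] (hX : Scheme.IsRegular X) {Y : Closeds X}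
    (hreg : Scheme.IsRegular (vanishingIdeal Y).subscheme) (hπ : IsBlowup π (vanishingIdeal Y))
    {J : X.IdealSheafData} {μ : ℕ} (hμ : 1 ≤ μ) (hY : ∀ y ∈ (Y : Set X), idealOrder J y = μ)
    {x' : X'} [IsRegularLocalRing (X.presheaf.stalk (π x'))]
    {c : Fin 2 → X.presheaf.stalk (π x')} (hcr : IsRsopPart c)
    (hcY : Ideal.span (Set.range c) = stalkIdeal (vanishingIdeal Y) (π x'))
    (j : Fin 2) {l : Fin 2} (hl : l ≠ j)
    (hadapt : ∀ G ∈ initialForms c (stalkIdeal J (π x')) μ,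
      ∃ c₀ : ResidueField (X.presheaf.stalk (π x')), G = MvPolynomial.C c₀ * MvPolynomial.X l ^ μ)
    (hnear : IsNear π (vanishingIdeal Y) J μ x') :
    IsRegularLocalRing (X'.presheaf.stalk x') ∧
      (maximalIdeal (X'.presheaf.stalk x')).spanFinrank =
        (maximalIdeal (X.presheaf.stalk (π x'))).spanFinrank := by
  classical
  have hx : π x' ∈ (Y : Set X) := by
    rw [← coe_support_vanishingIdeal, SetLike.mem_coe, mem_support_iff_stalkIdeal_le, ← hcY]
    exact hcr.span_range_le_maximalIdeal
  have hcm : ∀ i, c i ∈ maximalIdeal _ := hcr.mem_maximalIdeal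
  have hcq : IsQuasiRegular c := by
    obtain ⟨e, z, hd, hz, hzc⟩ := hcr.exists_rsop
    have h := isQuasiRegular_rsop_comp hd z hz (Fin.castAdd e) (Fin.castAdd_injective 2 e)
    rwa [show z ∘ Fin.castAdd e = c from funext hzc] at h
  -- a form `F` of degree `μ` with `F(c) ∈ J_x` and `F̄ ≠ 0`
  have hJP : stalkIdeal J (π x') ≤ Ideal.span (Set.range c) ^ μ := by
    rw [hcY, ← stalkIdeal_pow]
    exact stalkIdeal_mono (le_vanishingIdeal_pow_of_forall_idealOrder_eq hX hreg hY) _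
  have hJnot : ¬ stalkIdeal J (π x') ≤ maximalIdeal _ ^ (μ + 1) := by
    rw [← le_idealOrder_iff, hY (π x') hx]
    exact_mod_cast Nat.not_succ_le_self μ
  obtain ⟨f, hfJ, hf'⟩ := Set.not_subset.mp hJnot
  obtain ⟨F, hF, hFf⟩ := exists_isHomogeneous_of_mem_span_pow c μ (hJP hfJ)
  have hF0 : MvPolynomial.map (residue _) F ≠ 0 :=
    map_residue_ne_zero_of_eval_not_mem_pow_succ c hcm hF (by rw [hFf]; exact hf')
  have hFJ : MvPolynomial.eval c F ∈ stalkIdeal J (π x') := by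
    rw [hFf]
    exact hfJ
  have hGmem : MvPolynomial.map (residue _) F ∈ initialForms c (stalkIdeal J (π x')) μ :=
    (mem_initialForms_iff c).mpr ⟨F, hF, hFJ, rfl⟩
  -- a chart presentation of `x'`; the chart index is `j` by adaptedness
  obtain ⟨j₀, 𝔴, χ, hχ, hloc, h𝔴⟩ := hπ.exists_reesChart_stalk x' c hcY
  have h𝔴' : (maximalIdeal _).map (chartBase c j₀) ≤ 𝔴.asIdeal := by
    rw [← h𝔴]
    exact Ideal.map_comap_le
  have hnearF : ∀ F : MvPolynomial (Fin 2) (X.presheaf.stalk (π x')), F.IsHomogeneous μ →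
      MvPolynomial.eval c F ∈ stalkIdeal J (π x') →
      (algebraMap (chartRing c j₀) (Localization.AtPrime 𝔴.asIdeal) :
          chartRing c j₀ →+* Localization.AtPrime 𝔴.asIdeal)
          (MvPolynomial.eval₂Hom (chartBase c j₀) (fun i => chartGen c j₀ i) F) ∈
        maximalIdeal (Localization.AtPrime 𝔴.asIdeal) ^ μ :=
    fun F hF hFJ => algebraMap_eval₂Hom_mem_pow_of_isNear hcY j₀ 𝔴 χ hχ hloc hnear hF hFJ
  have hj₀ : j₀ = j := by
    by_contra hne
    have hjl : j₀ = l := Fin.eq_of_ne_of_ne' hne hl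
    subst hjl
    obtain ⟨a, ha⟩ :=
      exists_forall_mem_initialForms_eq_C_mul_pow c j₀ (l := j) (Ne.symm hne) hcq hcm 𝔴.asIdeal
        h𝔴' hμ hnearF
    obtain ⟨c₀, hc₀⟩ := hadapt _ hGmem
    obtain ⟨c₀', hc₀'⟩ := ha _ hGmem
    exact false_of_eq_C_mul_pow_of_eq_C_mul_sub_pow' hl hμ hF0 hc₀ hc₀'
  subst hj₀
  have he : chartGen c j₀ l ∈ 𝔴.asIdeal :=
    chartGen_mem_of_near_of_adapted c j₀ hl hcq hcm hμ 𝔴.asIdeal h𝔴' hnearF hadapt hF hFJ hF0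
  letI := χ.toAlgebra
  haveI : IsLocalization.AtPrime (X'.presheaf.stalk x') 𝔴.asIdeal := hloc
  exact isRegularLocalRing_and_spanFinrank_eq_of_origin hcr j₀ hl 𝔴.asIdeal h𝔴 he
    (X'.presheaf.stalk x')

/-- **[CoP1] Lemma 4.3 (4): a near point over a point of a curve centre is a regular point of the
same embedding dimension** (coordinate free): shear to adapted coordinates with the direction `a`
read off the near point itself (`exists_forall_mem_initialForms_eq_C_mul_pow`,
`initialForms_shiftRsop_adapted`), then the adapted statement. In the threefold situation of
Prop. 4.4 this is "`x′` is again a closed point of a regular threefold with regular parameters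
`(y₁′, y₂′, y₃)`". [cite: CossartPiltant2008, Lemma 4.3 (4)] -/
theorem IsBlowup.isRegularLocalRing_and_spanFinrank_eq_of_isNear_curve [IsLocallyNoetherian X]
    [IsLocallyNoetherian X'] (hX : Scheme.IsRegular X) {Y : Closeds X}
    (hreg : Scheme.IsRegular (vanishingIdeal Y).subscheme) (hπ : IsBlowup π (vanishingIdeal Y))
    {J : X.IdealSheafData} {μ : ℕ} (hμ : 1 ≤ μ) (hY : ∀ y ∈ (Y : Set X), idealOrder J y = μ)
    {x' : X'} [IsRegularLocalRing (X.presheaf.stalk (π x'))]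
    {c : Fin 2 → X.presheaf.stalk (π x')} (hcr : IsRsopPart c)
    (hcY : Ideal.span (Set.range c) = stalkIdeal (vanishingIdeal Y) (π x'))
    (hnear : IsNear π (vanishingIdeal Y) J μ x') :
    IsRegularLocalRing (X'.presheaf.stalk x') ∧
      (maximalIdeal (X'.presheaf.stalk x')).spanFinrank =
        (maximalIdeal (X.presheaf.stalk (π x'))).spanFinrank := by
  classical
  have hcm : ∀ i, c i ∈ maximalIdeal _ := hcr.mem_maximalIdeal
  have hcq : IsQuasiRegular c := by
    obtain ⟨e, z, hd, hz, hzc⟩ := hcr.exists_rsop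
    have h := isQuasiRegular_rsop_comp hd z hz (Fin.castAdd e) (Fin.castAdd_injective 2 e)
    rwa [show z ∘ Fin.castAdd e = c from funext hzc] at h
  obtain ⟨j, 𝔴, χ, hχ, hloc, h𝔴⟩ := hπ.exists_reesChart_stalk x' c hcY
  have h𝔴' : (maximalIdeal _).map (chartBase c j) ≤ 𝔴.asIdeal := by
    rw [← h𝔴]
    exact Ideal.map_comap_le
  obtain ⟨l, hl⟩ : ∃ l : Fin 2, l ≠ j := ⟨j + 1, by fin_cases j <;> decide⟩
  have hnearF : ∀ F : MvPolynomial (Fin 2) (X.presheaf.stalk (π x')), F.IsHomogeneous μ →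
      MvPolynomial.eval c F ∈ stalkIdeal J (π x') →
      (algebraMap (chartRing c j) (Localization.AtPrime 𝔴.asIdeal) :
          chartRing c j →+* Localization.AtPrime 𝔴.asIdeal)
          (MvPolynomial.eval₂Hom (chartBase c j) (fun i => chartGen c j i) F) ∈
        maximalIdeal (Localization.AtPrime 𝔴.asIdeal) ^ μ :=
    fun F hF hFJ => algebraMap_eval₂Hom_mem_pow_of_isNear hcY j 𝔴 χ hχ hloc hnear hF hFJ
  obtain ⟨a, ha⟩ :=
    exists_forall_mem_initialForms_eq_C_mul_pow c j hl hcq hcm 𝔴.asIdeal h𝔴' hμ hnearF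
  obtain ⟨ã, hã⟩ := residue_surjective (R := X.presheaf.stalk (π x')) a
  have ha' : ∀ G ∈ initialForms c (stalkIdeal J (π x')) μ, ∃ c₀ : ResidueField _,
      G = MvPolynomial.C c₀ * (MvPolynomial.X l -
        MvPolynomial.C (residue _ ã) * MvPolynomial.X j) ^ μ := by
    rw [hã]; exact ha
  have hadapt := initialForms_shiftRsop_adapted c j hl ã ha'
  have hcr₂ : IsRsopPart (shiftRsop c j fun _ => ã) := hcr.shiftRsop j ã
  have hcY₂ : Ideal.span (Set.range (shiftRsop c j fun _ => ã)) =
      stalkIdeal (vanishingIdeal Y) (π x') := by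
    rw [span_range_shiftRsop, hcY]
  exact hπ.isRegularLocalRing_and_spanFinrank_eq_of_isNear_curve_of_adapted hX hreg hμ hY hcr₂
    hcY₂ j hl hadapt hnear


/-! ## The regular parameters at the near point: `(c_j, c_l/c_j, w)` -/

/-- **At an origin prime of the `c_j`-chart the chart family `(c_j, e_l, w)` IS a regular system of
parameters of the local ring** (`w` completing the pair `c` to a regular system of parameters of
`R`): `L` is regular of embedding dimension `2 + e` and `(c_j, e_l, w_1, …, w_e)` (all read in `L`)
generate `𝔪_L` — [CoP1] Lemma 4.3 (4): "`x′ := (y₁′ = y₁, y₂′ = y₂/y₁, y₃)`", the input shape of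
the curve step of the polygon calculus (`CurveStepPrepared.lean`: `c′₁ = φ u₁`, `φ y = φ u₁ · y′`,
`c′₂ = φ u₂`). [cite: CossartPiltant2008, Lemma 4.3 (4) (proof)] [cite: DeJong1996, 2.4] -/
theorem span_range_chartFamily_eq_maximalIdeal_of_origin {R : Type u} [CommRing R]
    [IsRegularLocalRing R] (c : Fin 2 → R) (j : Fin 2) {l : Fin 2} (hl : l ≠ j) {e : ℕ}
    (w : Fin e → R) (hz : Ideal.span (Set.range (Fin.append c w)) = maximalIdeal R)
    (hd : (maximalIdeal R).spanFinrank = 2 + e)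
    (𝔴 : Ideal (chartRing c j)) [𝔴.IsPrime] (h𝔴 : 𝔴.comap (chartBase c j) = maximalIdeal R)
    (he : chartGen c j l ∈ 𝔴) (L : Type u) [CommRing L] [IsLocalRing L] [Algebra (chartRing c j) L]
    [IsLocalization.AtPrime L 𝔴] :
    IsRegularLocalRing L ∧ (maximalIdeal L).spanFinrank = 2 + e ∧
      Ideal.span (Set.range (chartFamily c j w L (chartBase c j) (chartGen c j)
        fun _ : Fin 1 => (⟨l, hl⟩ : {i : Fin 2 // i ≠ j}))) = maximalIdeal L := by
  classical
  have hrsop := isRsopPart_chartFamily_reesChart c j w hz hd 𝔴 h𝔴 L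
    (fun _ : Fin 1 => (⟨l, hl⟩ : {i : Fin 2 // i ≠ j})) (fun a b _ => Subsingleton.elim a b)
    (fun _ => he)
  haveI hLreg : IsRegularLocalRing L := hrsop.isRegularLocalRing
  obtain ⟨e', y, hdim, hy, hyz⟩ := hrsop.exists_rsop
  haveI := isDomain_of_isRegularLocalRing R
  have hdimL : ringKrullDim L ≤ ringKrullDim R := ringKrullDim_localization_chartRing_le c j 𝔴 h𝔴 L
  have hR : ((maximalIdeal R).spanFinrank : WithBot ℕ∞) = ringKrullDim R :=
    IsRegularLocalRing.spanFinrank_maximalIdeal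
  have hL : ((maximalIdeal L).spanFinrank : WithBot ℕ∞) = ringKrullDim L :=
    IsRegularLocalRing.spanFinrank_maximalIdeal
  rw [← hR, ← hL, hd, hdim] at hdimL
  have he0 : e' = 0 := by
    have : 1 + e + 1 + e' ≤ 2 + e := by exact_mod_cast hdimL
    omega
  subst he0
  refine ⟨hLreg, by rw [hdim]; ring, ?_⟩
  -- `range y = range (chartFamily)`
  have hrange : Set.range y = Set.range (chartFamily c j w L (chartBase c j) (chartGen c j)
      fun _ : Fin 1 => (⟨l, hl⟩ : {i : Fin 2 // i ≠ j})) := by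
    ext z
    constructor
    · rintro ⟨i, rfl⟩
      exact ⟨i, by rw [← hyz i]; rfl⟩
    · rintro ⟨i, rfl⟩
      exact ⟨Fin.castAdd 0 i, hyz i⟩
  rw [← hrange, hy]

set_option maxHeartbeats 800000 in
/-- **[CoP1] Lemma 4.3 (4): the regular parameters `(y₁, y₂/y₁, y₃)` at the near point over a point of
a curve centre** (adapted coordinates). In the situation of
`IsBlowup.isRegularLocalRing_and_spanFinrank_eq_of_isNear_curve_of_adapted`, with `w` completing the
adapted pair `c` to a regular system of parameters of `𝒪_{X,x}`: there is a chart presentation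
`χ : B_j → 𝒪_{X′,x′}` (`χ ∘ φ = π^*`, `𝒪_{X′,x′} = (B_j)_𝔴`, `𝔴` over `𝔪_x`, `e_l ∈ 𝔴`) such that
`(π^*c_j, χ(e_l), π^*w)` is a regular system of parameters of the regular local ring `𝒪_{X′,x′}`
(of embedding dimension `2 + e`) and `π^*c_l = π^*c_j · χ(e_l)`.
[cite: CossartPiltant2008, Lemma 4.3 (4) (proof)] -/
theorem IsBlowup.exists_chart_rsop_of_isNear_curve_of_adapted
    [IsLocallyNoetherian X] [IsLocallyNoetherian X'] (hX : Scheme.IsRegular X) {Y : Closeds X}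
    (hreg : Scheme.IsRegular (vanishingIdeal Y).subscheme) (hπ : IsBlowup π (vanishingIdeal Y))
    {J : X.IdealSheafData} {μ : ℕ} (hμ : 1 ≤ μ) (hY : ∀ y ∈ (Y : Set X), idealOrder J y = μ)
    {x' : X'} [IsRegularLocalRing (X.presheaf.stalk (π x'))]
    {c : Fin 2 → X.presheaf.stalk (π x')} (hcr : IsRsopPart c)
    (hcY : Ideal.span (Set.range c) = stalkIdeal (vanishingIdeal Y) (π x'))
    (j : Fin 2) {l : Fin 2} (hl : l ≠ j)
    (hadapt : ∀ G ∈ initialForms c (stalkIdeal J (π x')) μ,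
      ∃ c₀ : ResidueField (X.presheaf.stalk (π x')), G = MvPolynomial.C c₀ * MvPolynomial.X l ^ μ)
    (hnear : IsNear π (vanishingIdeal Y) J μ x') {e : ℕ} (w : Fin e → X.presheaf.stalk (π x'))
    (hz : Ideal.span (Set.range (Fin.append c w)) = maximalIdeal _)
    (hd : (maximalIdeal (X.presheaf.stalk (π x'))).spanFinrank = 2 + e) :
    ∃ (𝔴 : PrimeSpectrum (chartRing c j)) (χ : chartRing c j →+* X'.presheaf.stalk x'),
      (∀ a, χ (chartBase c j a) = (π.stalkMap x').hom a) ∧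
      @IsLocalization.AtPrime _ _ (X'.presheaf.stalk x') _ χ.toAlgebra 𝔴.asIdeal _ ∧
      𝔴.asIdeal.comap (chartBase c j) = maximalIdeal _ ∧ chartGen c j l ∈ 𝔴.asIdeal ∧
      IsRegularLocalRing (X'.presheaf.stalk x') ∧
      (maximalIdeal (X'.presheaf.stalk x')).spanFinrank = 2 + e ∧
      (letI := χ.toAlgebra
       Ideal.span (Set.range (chartFamily c j w (X'.presheaf.stalk x') (chartBase c j) (chartGen c j)
         fun _ : Fin 1 => (⟨l, hl⟩ : {i : Fin 2 // i ≠ j}))) = maximalIdeal _) ∧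
      (π.stalkMap x').hom (c l) = (π.stalkMap x').hom (c j) * χ (chartGen c j l) := by
  classical
  have hx : π x' ∈ (Y : Set X) := by
    rw [← coe_support_vanishingIdeal, SetLike.mem_coe, mem_support_iff_stalkIdeal_le, ← hcY]
    exact hcr.span_range_le_maximalIdeal
  have hcm : ∀ i, c i ∈ maximalIdeal _ := hcr.mem_maximalIdeal
  have hcq : IsQuasiRegular c := by
    obtain ⟨e₀, z, hd₀, hz₀, hzc⟩ := hcr.exists_rsop
    have h := isQuasiRegular_rsop_comp hd₀ z hz₀ (Fin.castAdd e₀) (Fin.castAdd_injective 2 e₀)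
    rwa [show z ∘ Fin.castAdd e₀ = c from funext hzc] at h
  -- a form `F` of degree `μ` with `F(c) ∈ J_x` and `F̄ ≠ 0`
  have hJP : stalkIdeal J (π x') ≤ Ideal.span (Set.range c) ^ μ := by
    rw [hcY, ← stalkIdeal_pow]
    exact stalkIdeal_mono (le_vanishingIdeal_pow_of_forall_idealOrder_eq hX hreg hY) _
  have hJnot : ¬ stalkIdeal J (π x') ≤ maximalIdeal _ ^ (μ + 1) := by
    rw [← le_idealOrder_iff, hY (π x') hx]
    exact_mod_cast Nat.not_succ_le_self μ
  obtain ⟨f, hfJ, hf'⟩ := Set.not_subset.mp hJnot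
  obtain ⟨F, hF, hFf⟩ := exists_isHomogeneous_of_mem_span_pow c μ (hJP hfJ)
  have hF0 : MvPolynomial.map (residue _) F ≠ 0 :=
    map_residue_ne_zero_of_eval_not_mem_pow_succ c hcm hF (by rw [hFf]; exact hf')
  have hFJ : MvPolynomial.eval c F ∈ stalkIdeal J (π x') := by
    rw [hFf]
    exact hfJ
  have hGmem : MvPolynomial.map (residue _) F ∈ initialForms c (stalkIdeal J (π x')) μ :=
    (mem_initialForms_iff c).mpr ⟨F, hF, hFJ, rfl⟩
  -- a chart presentation of `x'`; the chart index is `j` by adaptedness; the prime is the origin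
  obtain ⟨j₀, 𝔴, χ, hχ, hloc, h𝔴⟩ := hπ.exists_reesChart_stalk x' c hcY
  have h𝔴' : (maximalIdeal _).map (chartBase c j₀) ≤ 𝔴.asIdeal := by
    rw [← h𝔴]
    exact Ideal.map_comap_le
  have hnearF : ∀ F : MvPolynomial (Fin 2) (X.presheaf.stalk (π x')), F.IsHomogeneous μ →
      MvPolynomial.eval c F ∈ stalkIdeal J (π x') →
      (algebraMap (chartRing c j₀) (Localization.AtPrime 𝔴.asIdeal) :
          chartRing c j₀ →+* Localization.AtPrime 𝔴.asIdeal)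
          (MvPolynomial.eval₂Hom (chartBase c j₀) (fun i => chartGen c j₀ i) F) ∈
        maximalIdeal (Localization.AtPrime 𝔴.asIdeal) ^ μ :=
    fun F hF hFJ => algebraMap_eval₂Hom_mem_pow_of_isNear hcY j₀ 𝔴 χ hχ hloc hnear hF hFJ
  have hj₀ : j₀ = j := by
    by_contra hne
    have hjl : j₀ = l := Fin.eq_of_ne_of_ne' hne hl
    subst hjl
    obtain ⟨a, ha⟩ :=
      exists_forall_mem_initialForms_eq_C_mul_pow c j₀ (l := j) (Ne.symm hne) hcq hcm 𝔴.asIdeal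
        h𝔴' hμ hnearF
    obtain ⟨c₀, hc₀⟩ := hadapt _ hGmem
    obtain ⟨c₀', hc₀'⟩ := ha _ hGmem
    exact false_of_eq_C_mul_pow_of_eq_C_mul_sub_pow' hl hμ hF0 hc₀ hc₀'
  subst hj₀
  have he : chartGen c j₀ l ∈ 𝔴.asIdeal :=
    chartGen_mem_of_near_of_adapted c j₀ hl hcq hcm hμ 𝔴.asIdeal h𝔴' hnearF hadapt hF hFJ hF0
  letI := χ.toAlgebra
  haveI : IsLocalization.AtPrime (X'.presheaf.stalk x') 𝔴.asIdeal := hloc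
  obtain ⟨hLreg, hdim, hspan⟩ :=
    span_range_chartFamily_eq_maximalIdeal_of_origin c j₀ hl w hz hd 𝔴.asIdeal h𝔴 he
      (X'.presheaf.stalk x')
  exact ⟨𝔴, χ, hχ, hloc, h𝔴, he, hLreg, hdim, hspan, stalkMap_apply_eq_mul_chartGen j₀ χ hχ l⟩

end Literature.AlgebraicGeometry.Resolution

end
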